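import Summits.ABC.IUTFork.Conditional.Layer5OfSV12
import Literature.IUT.HodgeTheaters.PiAvatarBaseKitProp68iGroup
import Literature.IUT.HodgeTheaters.PiAvatarBaseKitProp65i
import HarnessLib

/-!
# Layer-5 certificate, ADDITIVE PART v0.13 — [IUTchI] §6: the held rows Prop 6.5 (i) / 6.6 (ii) / 6.6 (iii) / 6.8 (i) AS PRINTED at the certificate's
# GENUINE kit — `Nonempty 𝕍` guards DISCHARGED, Prop 6.8 (i) GROUP clause and count `2·l` ADDED, same binders ((K″); abc-iut-L5-t13 «P68i-GROUP@GENUINE-KITS»,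
# abc-iut-w5-d086 Prop 6.5 (i) by name) (director-abc (C2); plan/L5/LAYER5-CERT-SPEC.md §7; abc-iut-L5-lead gen 6 RULINGS #69, #71 (4), #81 (1)(2),
# #83 (1), #84 (3); writer abc-iut-L5-d1 gen 7)

cert L5 v0.13 additive part (one module, PROOF-ONLY: no `def`, no `instance`, no `axiom`, no `sorry`, no `notation`; every input BY NAME; nothing of
v0–v0.12 is touched).  ONE theorem, then the top `layer5_of_S_v13`:

* (K″) `layer5_held_sec6_v13_genuineKit_asPrinted` — v0.10's (K′) (`layer5_held_sec6_v10_genuineKit_unramified`, p449860: the §6 held rows at the GENUINE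
  §6 base kit `InitialThetaData.baseKitOfTorsionMonodromy` (abc-iut-L5-t4 p446463) of an initial Θ-datum `D` at abc-iut-L5-t8's UNRAMIFIED torsion-monodromy
  datum `M'` (p448163), `hA := arrowCoveringClaims_pe_of_modLCuspLaws CG hL` (abc-iut-L5-t1 p448117), good-place signs `localArrowLaw_L2_sign_local`
  (abc-iut-L5-d5 p446471)) with the SAME binders DATA `D CG M' B` · LAWS `hS hL ΛBad`, in the PRINTED form: the `Nonempty 𝕍 →` guards of the typed
  predicates `IsoTorsor` (Prop 6.6 (ii)(iii)) / `EllBridgeSymmetry` (Prop 6.8 (i)) are DISCHARGED (`𝕍 ⊇ 𝕍^bad ≠ ∅`, Def 3.1 (b); abc-iut-L5-t13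
  `nonempty_indexCopy` over abc-iut-L5-t2 `Vbad_nonempty`), and Prop 6.8 (i) now carries its GROUP clause (the symmetries of `†φ^{Θell}_±` ARE the finite
  group `Aut_±(T)`: index bijection bijective onto `Aut_±(T)`, every chart reads `Aut_±(T) ⥲ 𝔽_l^{⋊±}`, transitive with stabilisers of order two;
  abc-iut-w5-d228 `ellBridgeSymmetryGroup_of_equivariant` p414952 BY NAME) and the COUNT `#Iso = 2·l`.  Closers BY NAME: abc-iut-w5-d086
  `prop65i_baseKitOfTorsionMonodromy_unramified` (PiAvatarBaseKitProp65i p452410; (α) route, no parity side condition) · abc-iut-L5-t13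
  `sec6_torsors_asPrinted_baseKitOfTorsionMonodromy_unramified` / `ellBridgeSymmetryGroup_baseKitOfTorsionMonodromy_unramified` /
  `card_ellBridgeIso_baseKitOfTorsionMonodromy_unramified` (PiAvatarBaseKitProp68iGroup p454902).  LAW 3 → 3 (unchanged); COVERAGE ↑ (every printed clause
  of the four §6 held rows now has a conjunct at the genuine kit: abc-iut-L5-lead PER-NODE CLAUSE CENSUS, fold #11).
* NOT IN THIS MODULE (RULINGS #84 (1)(b)/(3), binding): every (K)-type conjunct binding `E : EvalBinder` / `KitCore` over a Π-avatar kit — in particular a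
  Prop 6.7 / (γ) `ThetaAgrees` / F-2049 re-grounding over abc-iut-L5-t3's `kitCoreStandIn` (p452433/p453062) — is STRUCK: abc-iut-w4-d054's kernel obstruction
  `PiAvatarKitCoreObstruction` (p456090 = GAP G-w4d054g7-1: at a Π-avatar kit with CLOSED local groups `Π_v̲` the binder `E : EvalBinder`, hence `KitCore`, is
  UNINHABITED) makes such a conjunct VACUOUS, and an uninhabited binder certifies nothing.  Prop 6.7 keeps v0's kit-relative `layer5_held_prop67`; token
  IUTchI:Prop6.7 HELD:after-merge (holder abc-iut-w4-d054 base); the non-vacuous typing is abc-iut-L5-t3's outer-hom shell `PiAvatarOuterHom` /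
  `PiAvatarEvalSections` (p455871/p456293; (γ)-outer = `thetaAgreesOuter_ofEvalSections` modulo the `EvalSectionBinder` alone) — v0.14 bank, lead's booking.

CENSUS v0.13: headline most-reduced **CONE 35 (+2 record-laws in `P`, +1 in `M'`) · FACT 0 · side 16 · NV 3 — UNCHANGED** (same binder set as v0.10's (K′);
guards discharged, group clause + count added).  Nodes 139 unchanged; tokens IUTchI:Prop6.5(i)/6.6(ii)/6.6(iii)/6.8(i) stay HELD:after-merge (holder
abc-iut-L5-lead, class held-ruled(JOINT-NV-CG), RULINGS #81 (1)).  NV: the binder set {`CG`, `hS`, `M'`, `hL`, `B`, `ΛBad`} is JOINTLY NV-PENDING (row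
«JOINT-NV-CG (l cusps)», abc-iut-L5-t8 g7 stage B: B1 `InitialThetaDataTorsionCuspModel` p454544 ✓, B2–B6 in flight); single-binder witnesses of record:
`M'` (abc-iut-L5-t8 `exists_unramifiedTorsionMonodromy`, regeom — degenerate inertia, `IsEmpty CuspGalois` there, RULINGS #71), `hL` (abc-iut-L5-t1 `ArrowModel.modLCuspLaws`
p448735 / `pedOf_modLCuspLaws` p450225), `B` (NV #48), `ΛBad` (abc-iut-L5-d5 p446888 at the arrow stand-in), {`M`, `hA`, `hI`} jointly at `regeom₂` (abc-iut-w4-d077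
stage A, NV-L5 #53 `exists_torsionMonodromy_arrowCoveringClaims_hI` p454043) and {`Nonempty UnramifiedTorsionMonodromy`, `hA`, `hS`} jointly at `regeom₂`
with NONTRIVIAL `I_{ε′}` (NV-L5 #54: abc-iut-w4-d077 `cuspClassesNormaliserStable_regeom₂` / `exists_torsionMonodromy_claims_hI_hS` p455619,
`nonempty_unramifiedTorsionMonodromy_regeom₂` / `exists_unramifiedTorsionMonodromy_claims_hS` p455801 — a 4-label model: `CuspGalois` NOT inhabited there);
«`CG` + `hL` jointly» ONLY at stage B; E51 field-level conjuncts (v0.5/v0.11): NV-L5 #52 = abc-iut-w4-d050 A3 p452371 «[arithmetic function-field model; ∞κ×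
collapsed; Galois side tautological]».  RULINGS #71 (4): NO `Nonempty`-at-a-model conjunct in a certificate until stage B lands — none here.  §2 HONESTY NOTE
(RULINGS #83 (1)(c), mandatory): the §2 one-call conjuncts (β′)/(β″)/(γ) of v0.8–v0.12 are TYPED and consistent law-by-law but have NO JOINT kernel witness
of {`PiData`, `hTF`} today = GAP G-f193g4-1 (at the only `PiData`-inhabited datum `PiData.exists_temperedCurve_padicAffine`, Δ̂ ≅ Aff(ℤ_p), `hTF` is FALSE:
h = (0,−1) is detected by the sign character, h² = 1 is not; repair abc-iut-f-193 (3) via `exists_temperedCurve_of_charLevels` at F̂₂ in flight).  S-FREE.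
Post-freeze-additive modules imported for the closers (not cone members): PiAvatarBaseKitProp68iGroup (p454902, proof-only), PiAvatarBaseKitProp65i (p452410,
proof-only) — both over abc-iut-L5-t4's D13 kit modules (PiAvatarBaseKitOfTorsionMonodromy p446463, PiAvatarBaseKitNFInstances p450281; def-bearing, used
through their theorems and as kit TERMS).

Mochizuki, *Inter-universal Teichmüller theory I: construction of Hodge theaters*, kurims manuscript (May 2020) [cite: Mochizuki2012]
(D-0012 claim key; series status DISPUTED; pages = kurims preprint render IUTchI-kurims-url-690e7b3c6199).  HONEST FRAMING: nothing in this file asserts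
that abc is proved or refuted or takes a side on [IUTchIII] Cor. 3.12 (nor on [IUTchI]); every binder is an ASSUMPTION LABEL; `D`, `CG`, `M'`, `B` are
ORIGIN / INTERFACE DATA (nothing asserts that a given curve admits them); typed ≠ inhabited ≠ discharged; indexed ≠ endorsed; establishment = OUR kernel
check only.
-/

namespace Summit.ABC.IUTFork.Conditional

open CategoryTheory Literature.IUT.HodgeTheaters
universe u v w

section Sec6V13

/-! ## §6 (K″): the §6 held rows AS PRINTED at the certificate's genuine kit — `Nonempty 𝕍` guards DISCHARGED, Prop 6.8 (i) GROUP clause + count `2·l` added (abc-iut-L5-t13 p454902, abc-iut-w5-d086 p452410) -/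

/-- **(K″): v0.10's (K′) (`layer5_held_sec6_v10_genuineKit_unramified`: the [IUTchI] §6 held rows IUTchI:Prop6.5(i) / 6.6(ii) / 6.6(iii) / 6.8(i) at the
GENUINE §6 base kit `InitialThetaData.baseKitOfTorsionMonodromy` of an initial Θ-datum `D` at abc-iut-L5-t8's UNRAMIFIED torsion-monodromy datum `M'`,
`hA := arrowCoveringClaims_pe_of_modLCuspLaws CG hL` (abc-iut-L5-t1 p448117), good-place signs `localArrowLaw_L2_sign_local` (abc-iut-L5-d5 p446471)) with
the SAME binders DATA `D CG M' B` · LAWS `hS hL ΛBad`, now in the PRINTED (UNGUARDED) form**: the `Nonempty 𝕍 →` guards of abc-iut-L5-t4's typed predicates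
`IsoTorsor` / `EllBridgeSymmetry` are DISCHARGED (`𝕍 ⊇ 𝕍^bad ≠ ∅`, Def 3.1 (b): abc-iut-L5-t13 `nonempty_indexCopy` over abc-iut-L5-t2 `Vbad_nonempty`), and
Prop 6.8 (i) carries, besides «transitive, #Iso = 2·#T», its GROUP clause (p.168: the symmetries of `†φ^{Θell}_±` ARE the finite group `Aut_±(T)` — index
bijection bijective onto `Aut_±(T)`; every chart reads `Aut_±(T) ⥲ 𝔽_l^{⋊±}`; transitive on `T` with stabilisers of order two) and the COUNT `#Iso = 2·l`.
Closers BY NAME: abc-iut-w5-d086 `prop65i_baseKitOfTorsionMonodromy_unramified` (p452410; Prop 6.5 (i) by the (α) route `xiGroupCompat_of_sync`, no parity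
side condition) · abc-iut-L5-t13 `sec6_torsors_asPrinted_baseKitOfTorsionMonodromy_unramified` / `ellBridgeSymmetryGroup_baseKitOfTorsionMonodromy_unramified` /
`card_ellBridgeIso_baseKitOfTorsionMonodromy_unramified` (p454902; (β) `negCompatModel_baseKitOfTorsionMonodromy` + abc-iut-w5-d228 `ellBridgeSymmetryGroup_of_equivariant`
p414952).  BINDERS, exhaustively = v0.10's: DATA `D` (+ instances) · `CG` · `M'` (record-law `tau_inertia` inside) · `B`; LAWS `hS` · `hL` · `ΛBad` (3).  Census:
UNCHANGED headline (same binder set; COVERAGE ↑: guards discharged, group clause, count).  NV: the set {CG, hS, M', hL, B, ΛBad} is jointly NV-PENDING (row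
«JOINT-NV-CG», abc-iut-L5-t8 g7 stage B; RULINGS #71 (4): NO `Nonempty`-at-a-model conjunct here).  Tokens IUTchI:Prop6.5(i)/6.6(ii)/6.6(iii)/6.8(i) stay
HELD:after-merge (holder abc-iut-L5-lead, class held-ruled(JOINT-NV-CG), RULINGS #81 (1)).  Nothing here asserts that abc is proved or refuted or takes a side
on [IUTchIII] Cor. 3.12; a binder is an assumption label; typed ≠ inhabited ≠ discharged. ([IUTchI] Prop 6.5 (i) pp.163–164, Prop 6.6 (ii)(iii) p.165,
Prop 6.8 (i) p.168) -/
theorem layer5_held_sec6_v13_genuineKit_asPrinted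
    {F : Type u} {K : Type v} {Fbar : Type w} [Field F] [NumberField F] [Field K] [NumberField K]
    [Algebra F K] [Field Fbar] [Algebra F Fbar] [Algebra K Fbar]
    {E : WeierstrassCurve F} [E.IsElliptic] {l : ℕ} {Pb : BadPlacePredicates K}
    (D : InitialThetaData F K Fbar E l Pb) [Fact l.Prime]
    -- DATA: cusp/Galois interface, UNRAMIFIED torsion monodromy, bad-pair data
    (CG : D.geom.pe.CuspGalois) (M' : D.UnramifiedTorsionMonodromy) (B : ∀ v, v ∈ D.indexCopyBad → D.BadPairAt v)
    -- LAWS: cusp-class normaliser stability, t1's SIX printed cusp laws mod `l`, bad-place local arrow laws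
    (hS : D.CuspClassesNormaliserStable) (hL : D.geom.pe.ModLCuspLaws)
    (ΛBad : ∀ v (h : v ∈ D.indexCopyBad), D.LocalArrowLaw CG hS (B v h).H) :
    ((∀ Bθ : (D.baseKitOfTorsionMonodromy CG hS M'.toTorsionMonodromy (D.arrowCoveringClaims_pe_of_modLCuspLaws CG hL)
        M'.tau_inertia_ε1 B
        (fun v _ => D.localArrowLaw_L2_sign_local CG hS (D.arrowCoveringClaims_pe_of_modLCuspLaws CG hL) (D.decompAt v)) ΛBad).DThetaEllBridge, Bθ.InducesZeta) ∧
      ∀ Bθ : (D.baseKitOfTorsionMonodromy CG hS M'.toTorsionMonodromy (D.arrowCoveringClaims_pe_of_modLCuspLaws CG hL)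
        M'.tau_inertia_ε1 B
        (fun v _ => D.localArrowLaw_L2_sign_local CG hS (D.arrowCoveringClaims_pe_of_modLCuspLaws CG hL) (D.decompAt v)) ΛBad).DThetaEllBridge, Bθ.XiGroupCompat) ∧  -- IUTchI:Prop6.5(i)
    (∀ B₁ B₂ : (D.baseKitOfTorsionMonodromy CG hS M'.toTorsionMonodromy (D.arrowCoveringClaims_pe_of_modLCuspLaws CG hL)
        M'.tau_inertia_ε1 B
        (fun v _ => D.localArrowLaw_L2_sign_local CG hS (D.arrowCoveringClaims_pe_of_modLCuspLaws CG hL) (D.decompAt v)) ΛBad).DThetaEllBridge,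
      Nonempty (PMBaseKit.DThetaEllBridge.Iso B₁ B₂) ∧
        Function.Bijective fun g : PMBaseKit.DThetaEllBridge.Iso B₁ B₂ =>
          (⟨g.indexEquiv, g.indexEquiv_charts⟩ : {ι : B₁.T ≃ B₂.T // B₁.torT.Compat B₂.torT ι})) ∧  -- IUTchI:Prop6.6(ii) AS PRINTED (unguarded)
    (∀ H₁ H₂ : (D.baseKitOfTorsionMonodromy CG hS M'.toTorsionMonodromy (D.arrowCoveringClaims_pe_of_modLCuspLaws CG hL)
        M'.tau_inertia_ε1 B
        (fun v _ => D.localArrowLaw_L2_sign_local CG hS (D.arrowCoveringClaims_pe_of_modLCuspLaws CG hL) (D.decompAt v)) ΛBad).DThetaPMEllHT,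
      Nonempty (PMBaseKit.DThetaPMEllHT.Iso H₁ H₂) ∧
        Function.Bijective fun g : PMBaseKit.DThetaPMEllHT.Iso H₁ H₂ =>
          (⟨g.pmIso.indexEquiv, g.pmIso.indexEquiv_charts⟩ : {ι : H₁.T ≃ H₂.T // H₁.grpT.Compat H₂.grpT ι})) ∧  -- IUTchI:Prop6.6(iii) AS PRINTED (unguarded)
    (∀ H : (D.baseKitOfTorsionMonodromy CG hS M'.toTorsionMonodromy (D.arrowCoveringClaims_pe_of_modLCuspLaws CG hL)
        M'.tau_inertia_ε1 B
        (fun v _ => D.localArrowLaw_L2_sign_local CG hS (D.arrowCoveringClaims_pe_of_modLCuspLaws CG hL) (D.decompAt v)) ΛBad).DThetaPMEllHT,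
      ((∀ t₁ t₂ : H.T, ∃ g : PMBaseKit.DThetaEllBridge.Iso H.ellBridge H.ellBridge, g.indexEquiv t₁ = t₂) ∧
        Nat.card (PMBaseKit.DThetaEllBridge.Iso H.ellBridge H.ellBridge) = 2 * Nat.card H.T) ∧  -- IUTchI:Prop6.8(i) AS PRINTED (unguarded): transitive, #Iso = 2·#T
      Nat.card (PMBaseKit.DThetaEllBridge.Iso H.ellBridge H.ellBridge) = 2 * l ∧  -- IUTchI:Prop6.8(i): the count #Iso = 2·l
      (Function.Bijective (fun g : PMBaseKit.DThetaEllBridge.Iso H.ellBridge H.ellBridge =>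
          (⟨(g.indexEquiv : Equiv.Perm H.T), H.ellBridgeIso_indexEquiv_mem_autPM g⟩ : H.grpT.toTorsor.autPM)) ∧
        (∀ e ∈ H.grpT.toTorsor.charts, ∃ φ : H.grpT.toTorsor.autPM ≃* FlPM l,
          ∀ (σ : H.grpT.toTorsor.autPM) (t : H.T), e (σ.1 t) = φ σ • e t) ∧
        MulAction.IsPretransitive H.grpT.toTorsor.autPM H.T ∧
        ∀ t : H.T, Nat.card (MulAction.stabilizer H.grpT.toTorsor.autPM t) = 2)) :=  -- IUTchI:Prop6.8(i): the GROUP clause (Aut_±(T) ≅ 𝔽_l^{⋊±}, stabilisers of order 2)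
  ⟨D.prop65i_baseKitOfTorsionMonodromy_unramified CG hS M' B hL ΛBad,
   (D.sec6_torsors_asPrinted_baseKitOfTorsionMonodromy_unramified CG hS M' B hL ΛBad).1,
   (D.sec6_torsors_asPrinted_baseKitOfTorsionMonodromy_unramified CG hS M' B hL ΛBad).2.1,
   fun H => ⟨(D.sec6_torsors_asPrinted_baseKitOfTorsionMonodromy_unramified CG hS M' B hL ΛBad).2.2 H,
     D.card_ellBridgeIso_baseKitOfTorsionMonodromy_unramified CG hS M' B hL ΛBad H,
     D.ellBridgeSymmetryGroup_baseKitOfTorsionMonodromy_unramified CG hS M' B hL ΛBad H⟩⟩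

end Sec6V13

/-- **THE LAYER-5 CERTIFICATE v13 — SINGLE TOP OF RECORD**: the conjunction, BY NAME via `StatementOf`, of the v12 top `layer5_of_S_v12`
(`Conditional/Layer5OfSV12.lean`, p453916; through it v11 … v0 and the companion) and this module's `layer5_held_sec6_v13_genuineKit_asPrinted` ((K″)).
CENSUS v13: headline most-reduced CONE 35 (+2 record-laws in `P`, +1 in `M'`) · FACT 0 · side 16 · NV 3 (unchanged); §6 at the genuine kit now AS PRINTED
(guards discharged) with the Prop 6.8 (i) group clause and count; no `EvalBinder`/`KitCore`-bound conjunct (RULINGS #84 (3)).  S-FREE.  Nothing here asserts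
that abc is proved or refuted or takes a side on [IUTchIII] Cor. 3.12; a binder is an assumption label; typed ≠ discharged; indexed ≠ endorsed. -/
theorem layer5_of_S_v13 :
    Summit.ABC.IUTFork.DAG.PartL5a.StatementOf @layer5_of_S_v12 ∧
    Summit.ABC.IUTFork.DAG.PartL5a.StatementOf @layer5_held_sec6_v13_genuineKit_asPrinted :=
  ⟨@layer5_of_S_v12, @layer5_held_sec6_v13_genuineKit_asPrinted⟩

end Summit.ABC.IUTFork.Conditional
-- enqueue re-land 2026-08-26T18:03:33Z (abc-iut-L5-d1 g7): comment-only touch to re-queue the stranded olean build of this ACCEPTED module (p458154; farm «stale:unbuilt» at +47 min); no declaration changed.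

/-! ### Build-lane export guard (ops-buildfix bf1-g30, 2026-08-28; G11b-3 recipe v2 as in `GelbartRogawski1991/UnitaryDualPairSeesawCharacter`):
the theorems of this file carry very large dependent telescopes; at `.olean` export Lean 4.32's library-suggestion indexers fold over
every local theorem statement and do not finish within the build lane's one-hour clock (measured on a farm node: `lean -o` > 1 500 s, plain
elaboration ≈ 20 s). ONE file-final `local` `[implicit_reducible]` keeps them out of that premise index (inert for Meta and the kernel on
theorems; no definition is tagged; statements and proofs unchanged). -/
set_option allowUnsafeReducibility true in
attribute [local implicit_reducible]
  _root_.Summit.ABC.IUTFork.Conditional.layer5_held_sec6_v13_genuineKit_asPrinted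
  _root_.Summit.ABC.IUTFork.Conditional.layer5_of_S_v13
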